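import Summits.ResolutionOfSingularities.ResolutionOfSingularities.Theorems.PurelyInseparableDim4ResConeCInfLegalityPrime
import Summits.ResolutionOfSingularities.ResolutionOfSingularities.Theorems.PurelyInseparableDim4ResConeCInfGameStep
import HarnessLib
import HarnessLib.Audit.Tags

/-!
# Purely inseparable four-folds — TWO-SLOT POWER-CONE GAME, LEGALITY READING FOR EVERY STATE σ = (n, n) + w, EVERY PRIME:
# under a pure corner step of a straight framed σ-state the child stays straight, and a present parent game monomial is never a blocker
# (cell `res-dim4-pi`, K2(p) lane, B rows = power cones, row B-LF (iii-b) «K24a-PRIME readings», β-layer; seat res-dim4-p-7 g6)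

[OURS · counted 0 · cell `res-dim4-pi` · K2(p) lane (holder res-dim4-p-12 g5 rulings g5-17, bus 2026-08-29 12:20Z: «K24a-PRIME-σ =
THREE LAYERS, THREE OWNERS: step/α res-dim4-p-1 g6 (`…TwoSlotGameStepSigma`) · β-readings res-dim4-p-7 g6 · window transport
res-dim4-typ-1 g5»).  AUTHORSHIP of the method: res-dim4-p-1 g3's K24a-β5 `legal_readings_of_corner` (p688452, `(p, d) = (5, 3)`) and
res-dim4-p-3 g5's `cInf_legal_readings_of_corner_prime` (`…CInfLegalityPrime`, the light pair `n = 1`, `w = 0`, `d + 1 = p`, whose §1 —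
`linearForm_off_eq_zero_pow`, `coeff_powerCone_eq_zero_of_straight_pow` — is IMPORTED here, not restated); this file is the σ-PARAMETRIC
re-edition: slot weight `n ≥ 1` on the two slot letters `j, i`, passive weight `w` on the third letter `u`, form carrier `f`, numerology
`n + w + d = p`, in res-dim4-p-1 g6's dictionary `E(c,a,b,e) = (a+n+1)·j + (b+n+1)·i + (e+w)·u + (d−1−c)·f`.  The falsifiers this reading was
checked against before typing: res-dim4-eng-w5 g4's table v0 (KIT j330440, bus 11:43Z, (U): «LEGAL ⟺ no parent residual monomial with slot
exponent ≥ twice the excess degree», observed = predicted in 10 σ × 2 moves × 2 windows at `p = 7`) and this seat's exact linear bookkeeping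
`kb/legal_check.py` (15 states, set-equal).  Seat res-dim4-p-7 g6.]  Nothing here proves any TAIL(p, d, 3), K2(p), `NoIsolatedTrap p p` or
resolution of singularities in dimension ≥ 4 / characteristic `p` — NOT proved; a reading of ONE corner step of OUR frame.  AI kernel work,
weaker than expert review.

SETTING.  Boundary `r = n·j + n·i + w·u` (`r_f = 0`), `x^r ∣ F`, `ord₀ F = p + n` (`= 2n + w + d`, shade `d`), residual cone STRAIGHT at `f`
(`coeff_{r + d·e_f} F ≠ 0`, every other degree-`d` residual coefficient vanishes), Tschirnhaus row `coeff_{r + (d−1)e_f + 2e_j} F = 0`; the pure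
corner child `s′ = CentreBlowup.step p univ j 0 s` in the chart of the slot `j`.
* §1 `chartExponent_sigma_add` — the chart law `r + m̃ ↦ r + m̃.update j (|m̃| − d)` (the `p = n + w + d` cancels; = p-1's
  `chartExponent_gameExp_sigma` on residual exponents); `step_zero_r_sigma` (`r′ = r`).
* §2 **`twoSlot_legal_readings_of_corner_sigma (p) (hσ : n + w + d = p) (hn : 1 ≤ n) (hd2 : 2 ≤ d)`** — if the child has `ord₀ = p + n` and
  `e_G = 3` again then (i) it is STRAIGHT again (in the transported frame), (ii) `coeff_{r + d·e_f}` is carried identically, (iii) LEGAL(j): every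
  parent residual monomial `m̃ ≠ d·e_f` with `d ≤ |m̃|` and `2|m̃| ≤ m̃_j + 2d` is ABSENT.
* §3 **`twoSlot_legal_gameExp_sigma`** — (iii) in game coordinates: a PRESENT parent game monomial `E(c,a,b,e)` (`c + 1 ≤ d`) satisfies
  `2c ≤ a + 2b + 2e` — `CInfGame.Exact.no_infinite_play`'s `hlegL` letter for letter; **`twoSlot_legalM_gameExp_sigma`** — the step in the
  chart of the other slot `i`: `2c ≤ 2a + b + 2e` (`hlegM`); every prime, every σ.
[cite: CossartJannsenSaito2020, Thm. 3.14, Lemma 13.2] [cite: HauserPerlega2019PRIMS, §2 (the blowup in the x₁-chart)]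
bears_on: LADDER-RESOLUTION:D157-DOOR2 (res-dim4-pi · K2(p) · power cones · two-slot legality reading every prime, every σ).  Supports
stmt-ResolutionOfSingularities-16155 (helper).
-/

set_option linter.dupNamespace false -- mandated namespace of this single-conjunct summit

noncomputable section

namespace Summit.ResolutionOfSingularities.ResolutionOfSingularities.Theorems.PIDim4

namespace ResCone

open MvPolynomial Finset
open Literature.AlgebraicGeometry.Resolution
open Literature.AlgebraicGeometry.Resolution.CentreBlowup
open Literature.AlgebraicGeometry.Resolution.Hauser2010
open Literature.AlgebraicGeometry.Resolution.HauserPerlega2019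

variable {K : Type} [Field K]

/-! ## 1. Exponent bookkeeping over the σ-boundary `r = n·j + n·i + w·u`, order `p + n` -/

/-- **The chart image of a residual monomial over the σ-boundary**: `r = n·j + n·i + w·u`, `n + w + d = p`; for `|m̃| ≥ d`,
`chartExponent p univ j (r + m̃) = r + m̃.update j (|m̃| − d)` — the game's `(c, a, b, e) ↦ (c, a + b + e − c, b, e)`; `(p, n, w)` cancel.
[folklore] [cite: CossartJannsenSaito2020, Lemma 13.2] -/
theorem chartExponent_sigma_add (p : ℕ) {n w d : ℕ} (hσ : n + w + d = p) {j i u : Fin 4} (hji : j ≠ i) (hju : j ≠ u)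
    {r m : Fin 4 →₀ ℕ} (hr : r = Finsupp.single j n + Finsupp.single i n + Finsupp.single u w) (hm : d ≤ m.degree) :
    chartExponent p Finset.univ j (r + m) = r + m.update j (m.degree - d) := by
  have hrj : r j = n := by rw [hr]; simp [hji, hju]
  have hrdeg : r.degree = 2 * n + w := by
    rw [hr, map_add, map_add, Finsupp.degree_single, Finsupp.degree_single, Finsupp.degree_single]; ring
  rw [chartExponent_univ_eq_update]
  ext k
  by_cases hk : k = j
  · rw [hk, Finsupp.coe_update, Function.update_self, Finsupp.add_apply, Finsupp.coe_update,
      Function.update_self, map_add, hrdeg, hrj]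
    omega
  · rw [Finsupp.coe_update, Function.update_of_ne hk, Finsupp.add_apply, Finsupp.add_apply,
      Finsupp.coe_update, Function.update_of_ne hk]

/-- **A pure corner step in the chart of a slot keeps the σ-boundary vector** (`ord₀ F = p + n`, `r_j = n`). [folklore]
[cite: HauserPerlega2019PRIMS, §2 (transform D' of D)] -/
theorem step_zero_r_sigma [DecidableEq K] (p : ℕ) {n : ℕ} {j : Fin 4} {s : State K}
    (ho : ordZero s.F = ((p + n : ℕ) : ℕ∞)) (hrj : s.r j = n) :
    (CentreBlowup.step p Finset.univ j 0 s).r = s.r := by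
  rw [step_r_univ' p j 0 s ho]
  ext k
  rw [Finsupp.coe_update]
  by_cases hk : k = j
  · rw [hk, Function.update_self, hrj]; omega
  · rw [Function.update_of_ne hk, Finsupp.filter_apply, if_pos (show (0 : Fin 4 → K) k = 0 from rfl)]

/-! ## 2. LEGALITY of a pure corner step of a straight σ-state, read in the frame, every prime -/

section Legal

variable [DecidableEq K]

/-- **THE TRANSPORTED FRAME STRAIGHTENS THE CHILD, and LEGALITY, for every prime and every σ = (n, n) + w** (K24a-β5 ∀ σ ∀ p;
`n + w + d = p`, `1 ≤ n`, `2 ≤ d`).  Pure corner step in the chart of the slot `j` of a state with boundary `r = n·j + n·i + w·u`,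
`x^r ∣ F`, `ord₀ F = p + n`, STRAIGHT at the carrier `f` (`coeff_{r + d·e_f} F ≠ 0`, every other degree-`d` residual coefficient vanishes)
with the Tschirnhaus row `coeff_{r + (d−1)e_f + 2e_j} F = 0`; if the child `s′` has `ord₀ = p + n` and `e_G = 3` then: (i) the child is
straight again; (ii) `coeff_{r + d·e_f}` is carried identically; (iii) LEGAL(j): every parent residual monomial `m̃ ≠ d·e_f` with `d ≤ |m̃|`
and `2|m̃| ≤ m̃_j + 2d` (its chart image has residual degree `≤ d`) is absent — «slot exponent at least twice the excess degree ⇒ absent»,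
res-dim4-eng-w5's (U). [OURS · uniform LEGAL table, every prime, every σ] [cite: CossartJannsenSaito2020, Thm. 3.14] -/
theorem twoSlot_legal_readings_of_corner_sigma (p : ℕ) [Fact p.Prime] [CharP K p] {n w d : ℕ} (hσ : n + w + d = p)
    (hn : 1 ≤ n) (hd2 : 2 ≤ d) {j i u f : Fin 4} (hji : j ≠ i) (hju : j ≠ u) (hjf : j ≠ f) (hiu : i ≠ u) (hif : i ≠ f)
    (huf : u ≠ f) {s : State K} (hr : s.r = Finsupp.single j n + Finsupp.single i n + Finsupp.single u w)
    (hdiv : ∀ e ∈ s.F.support, s.r ≤ e) (ho : ordZero s.F = ((p + n : ℕ) : ℕ∞))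
    (ha : coeff (s.r + Finsupp.single f d) s.F ≠ 0)
    (hstraight : ∀ m : Fin 4 →₀ ℕ, m.degree = d → m ≠ Finsupp.single f d → coeff (s.r + m) s.F = 0)
    (htsch : coeff (s.r + (Finsupp.single f (d - 1) + Finsupp.single j 2)) s.F = 0)
    (ho' : ordZero (CentreBlowup.step p Finset.univ j 0 s).F = ((p + n : ℕ) : ℕ∞))
    (he3' : Module.finrank K (resVertex (CentreBlowup.step p Finset.univ j 0 s)) = 3) :
    (∀ m : Fin 4 →₀ ℕ, m.degree = d → m ≠ Finsupp.single f d →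
        coeff (s.r + m) (CentreBlowup.step p Finset.univ j 0 s).F = 0) ∧
      coeff (s.r + Finsupp.single f d) (CentreBlowup.step p Finset.univ j 0 s).F =
        coeff (s.r + Finsupp.single f d) s.F ∧
      ∀ m : Fin 4 →₀ ℕ, d ≤ m.degree → 2 * m.degree ≤ m j + 2 * d → m ≠ Finsupp.single f d →
        coeff (s.r + m) s.F = 0 := by
  have hp : p.Prime := Fact.out
  have hdK : (d : K) ≠ 0 := fun h => by
    have hdvd := (CharP.cast_eq_zero_iff K p d).mp h
    have := Nat.le_of_dvd (by omega) hdvd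
    omega
  set s' := CentreBlowup.step p Finset.univ j 0 s with hs'
  have hrj : s.r j = n := by rw [hr]; simp [hji, hju]
  have hri : s.r i = n := by rw [hr]; simp [hji.symm, hiu]
  have hrf : s.r f = 0 := by rw [hr]; simp [hjf.symm, hif.symm, huf.symm]
  have hr' : s'.r = s.r := step_zero_r_sigma p ho hrj
  have hrdeg : s.r.degree = 2 * n + w := by
    rw [hr, map_add, map_add, Finsupp.degree_single, Finsupp.degree_single, Finsupp.degree_single]; ring
  have hdiv' : ∀ e ∈ s'.F.support, s'.r ≤ e :=
    newMult_le_of_mem_support_step p Finset.univ j 0 rfl s ho hdiv (perm_univ ho hdiv)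
  have hq : ((p : ℕ) : ℕ∞) ≤ ordAlong Finset.univ s.F := by
    rw [ordAlong_univ, ho]; exact_mod_cast (by omega : p ≤ p + n)
  -- the chart law at residual monomials `r + m̃`, `|m̃| ≥ d`, `m̃ i ≤ w + d − 1` (so the image is no p-th power: its `i`-entry is
  -- `n + m̃ i ∈ [1, p − 1]`)
  have hchart : ∀ m : Fin 4 →₀ ℕ, d ≤ m.degree → m i ≤ w + d - 1 →
      coeff (s.r + m.update j (m.degree - d)) s'.F = coeff (s.r + m) s.F := by
    intro m hm hmi
    rw [← chartExponent_sigma_add p hσ hji hju hr hm, coeff_step_zero_chartExponent p j s hq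
      (by rw [map_add, hrdeg]; omega), if_neg (not_isPthPowerExponent_of_not_dvd (i := i) ?_)]
    rw [chartExponent_sigma_add p hσ hji hju hr hm, Finsupp.add_apply, hri, Finsupp.coe_update,
      Function.update_of_ne hji.symm]
    intro hdvd
    have := Nat.le_of_dvd (by omega) hdvd
    omega
  -- the child's residual cone and how to read the child at degree `p + n`
  obtain ⟨ℓ', c, -, -, hform⟩ := resForm_eq_C_mul_pow_of_finrank_eq_three p ho'
    (by rw [hr', hrdeg]; omega) he3'
  rw [hr', hrdeg, show p + n - (2 * n + w) = d by omega] at hform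
  have hread : ∀ m : Fin 4 →₀ ℕ, m.degree = d →
      coeff (s.r + m) s'.F = coeff m (C c * (∑ i, C (ℓ' i) * X i) ^ d) := by
    intro m hm
    have h := congrArg (coeff (s.r + m)) (monomial_mul_resForm hdiv')
    rw [hr', coeff_monomial_mul', if_pos le_self_add, one_mul, add_tsub_cancel_left, hform] at h
    rw [h]
    unfold initialForm
    rw [ho', ENat.toNat_coe, coeff_homogeneousComponent, if_pos (by rw [map_add, hrdeg, hm]; omega)]
  -- (i) the child is straight: no `x_f^{d−1} x_k`
  have hchild_straight : ∀ k, k ≠ f →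
      coeff (Finsupp.single k 1 + Finsupp.single f (d - 1)) (C c * (∑ i, C (ℓ' i) * X i) ^ d) = 0 := by
    intro k hk
    have hdegd : (Finsupp.single k 1 + Finsupp.single f (d - 1) : Fin 4 →₀ ℕ).degree = d := by
      rw [map_add, Finsupp.degree_single, Finsupp.degree_single]; omega
    rw [← hread _ hdegd]
    by_cases hkj : k = j
    · -- preimage: the Tschirnhaus monomial `r + (d−1)e_f + 2e_j`
      subst hkj
      have hpre_deg : (Finsupp.single f (d - 1) + Finsupp.single k 2 : Fin 4 →₀ ℕ).degree = d + 1 := by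
        rw [map_add, Finsupp.degree_single, Finsupp.degree_single]; omega
      have h := hchart (Finsupp.single f (d - 1) + Finsupp.single k 2) (by rw [hpre_deg]; omega) (by
        simp [hif, hji.symm])
      have hupd : (Finsupp.single f (d - 1) + Finsupp.single k 2 : Fin 4 →₀ ℕ).update k
          ((Finsupp.single f (d - 1) + Finsupp.single k 2 : Fin 4 →₀ ℕ).degree - d) =
          Finsupp.single k 1 + Finsupp.single f (d - 1) := by
        rw [hpre_deg]
        ext x; by_cases hx : x = k
        · subst hx
          simp only [Finsupp.coe_update, Function.update_self, Finsupp.add_apply, Finsupp.single_eq_same,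
            Finsupp.single_eq_of_ne hjf]
          omega
        · simp [Finsupp.coe_update, Function.update_of_ne hx, Finsupp.single_apply, Ne.symm hx]
      rw [hupd] at h
      rw [h]; exact htsch
    · -- preimage: `r + (d−1)e_f + e_k` itself (its `j`-exponent is `0`, its image has the same exponent)
      have h := hchart (Finsupp.single f (d - 1) + Finsupp.single k 1) (by
        rw [map_add, Finsupp.degree_single, Finsupp.degree_single]; omega) (by
        simp only [Finsupp.add_apply, Finsupp.single_apply, if_neg hif.symm, zero_add]
        split_ifs <;> omega)
      have hupd : (Finsupp.single f (d - 1) + Finsupp.single k 1 : Fin 4 →₀ ℕ).update j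
          ((Finsupp.single f (d - 1) + Finsupp.single k 1 : Fin 4 →₀ ℕ).degree - d) =
          Finsupp.single k 1 + Finsupp.single f (d - 1) := by
        have hdeg' : (Finsupp.single f (d - 1) + Finsupp.single k 1 : Fin 4 →₀ ℕ).degree = d := by
          rw [map_add, Finsupp.degree_single, Finsupp.degree_single]; omega
        rw [hdeg', Nat.sub_self]
        ext x; by_cases hx : x = j
        · subst hx; simp [hjf, Ne.symm hkj]
        · simp only [Finsupp.coe_update, Function.update_of_ne hx, Finsupp.add_apply]
          ring
      rw [hupd] at h
      rw [h]
      refine hstraight _ (by rw [map_add, Finsupp.degree_single, Finsupp.degree_single]; omega) fun heq => hk ?_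
      have := DFunLike.congr_fun heq k
      simp [Ne.symm hk] at this
  -- (ii) the `x_f^d` coefficient is carried (`r + d·e_f` is fixed by the chart law)
  have hxd : coeff (s.r + Finsupp.single f d) s'.F = coeff (s.r + Finsupp.single f d) s.F := by
    have h := hchart (Finsupp.single f d) (by rw [Finsupp.degree_single]) (by simp [hif])
    have hupd : (Finsupp.single f d : Fin 4 →₀ ℕ).update j ((Finsupp.single f d : Fin 4 →₀ ℕ).degree - d) =
        Finsupp.single f d := by
      rw [Finsupp.degree_single, Nat.sub_self]
      ext x; by_cases hx : x = j
      · subst hx; simp [hjf.symm]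
      · simp [Finsupp.coe_update, Function.update_of_ne hx]
    rwa [hupd] at h
  have hcd : coeff (Finsupp.single f d) (C c * (∑ i, C (ℓ' i) * X i) ^ d) ≠ 0 := by
    rw [← hread _ (Finsupp.degree_single f d), hxd]; exact ha
  -- (i) every other degree-`d` residual coefficient of the child vanishes
  have hzero : ∀ m : Fin 4 →₀ ℕ, m.degree = d → m ≠ Finsupp.single f d → coeff (s.r + m) s'.F = 0 :=
    fun m hm hne => by
      rw [hread m hm]; exact coeff_powerCone_eq_zero_of_straight_pow f hdK hcd hchild_straight hne
  refine ⟨hzero, hxd, fun m hmd hle hne => ?_⟩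
  -- (iii) LEGAL(j): the image of `m̃` has residual degree `≤ d`
  have hdeg' := degree_update_add m j (m.degree - d)
  by_cases hmi : m i ≤ w + d - 1
  · rw [← hchart m hmd hmi]
    by_cases hd' : (m.update j (m.degree - d)).degree = d
    · refine hzero _ hd' fun heq => hne ?_
      -- `m̃.update j (|m̃| − d) = d·e_f` forces `|m̃| = d`, `m̃ f = d`, hence `m̃ = d·e_f`
      have hj0 : m.degree - d = 0 := by
        have := DFunLike.congr_fun heq j
        rw [Finsupp.coe_update, Function.update_self, Finsupp.single_apply, if_neg (Ne.symm hjf)] at this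
        exact this
      have hmf : m f = d := by
        have := DFunLike.congr_fun heq f
        rw [Finsupp.coe_update, Function.update_of_ne (Ne.symm hjf), Finsupp.single_eq_same] at this
        exact this
      exact eq_single_of_degree_eq_of_apply_eq (by omega) hmf
    · refine coeff_eq_zero_of_degree_lt_ordZero ?_
      rw [ho', map_add, hrdeg]
      exact_mod_cast (by omega : 2 * n + w + (m.update j (m.degree - d)).degree < p + n)
  · -- `m̃ i ≥ w + d`: then `w = 0`, `m̃ j = 0`, `|m̃| = d`, and the parent coefficient vanishes by straightness directly
    have hji' := degree_eq_apply_add_apply_add_degIn hji m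
    exact hstraight m (by omega) hne

end Legal

/-! ## 3. The legality reading in game coordinates `E(c,a,b,e)`, every prime, every σ -/

section Game

variable [DecidableEq K]
variable {j i u f : Fin 4} (hji : j ≠ i) (hju : j ≠ u) (hjf : j ≠ f) (hiu : i ≠ u) (hif : i ≠ f) (huf : u ≠ f)
include hji hju hjf hiu hif huf

omit [DecidableEq K] in
/-- The σ-game exponent is the σ-boundary plus the residual exponent `(a+1)·j + (b+1)·i + e·u + (d−1−c)·f`. [OURS · bookkeeping] -/
theorem gameExp_eq_boundary_add {n w d c : ℕ} (a b e : ℕ) {r : Fin 4 →₀ ℕ}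
    (hr : r = Finsupp.single j n + Finsupp.single i n + Finsupp.single u w) :
    (Finsupp.single j (a + n + 1) + Finsupp.single i (b + n + 1) + Finsupp.single u (e + w) + Finsupp.single f (d - 1 - c) :
      Fin 4 →₀ ℕ) = r + (Finsupp.single j (a + 1) + Finsupp.single i (b + 1) + Finsupp.single u e + Finsupp.single f (d - 1 - c)) := by
  rw [hr]
  ext k
  rcases letters_exhaust hji hju hjf hiu hif huf k with rfl | rfl | rfl | rfl
  · simp [hji, hju, hjf]; omega
  · simp [hji.symm, hiu, hif]; omega
  · simp [hju.symm, hiu.symm, huf]; omega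
  · simp [hjf.symm, hif.symm, huf.symm]

/-- **LEGAL(j) IN GAME COORDINATES, every prime, every σ** — `CInfGame.Exact.no_infinite_play`'s `hlegL` letter for letter: under the
hypotheses of `twoSlot_legal_readings_of_corner_sigma` (pure corner step in the chart of the slot `j` of a straight σ-state whose child keeps
`ord₀ = p + n` and `e_G = 3`), a PRESENT parent game monomial `E(c,a,b,e)`, `c + 1 ≤ d`, satisfies `2c ≤ a + 2b + 2e`. [OURS]
[cite: CossartJannsenSaito2020, Thm. 3.14] -/
theorem twoSlot_legal_gameExp_sigma (p : ℕ) [Fact p.Prime] [CharP K p] {n w d : ℕ} (hσ : n + w + d = p) (hn : 1 ≤ n)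
    (hd2 : 2 ≤ d) {s : State K} (hr : s.r = Finsupp.single j n + Finsupp.single i n + Finsupp.single u w)
    (hdiv : ∀ e ∈ s.F.support, s.r ≤ e) (ho : ordZero s.F = ((p + n : ℕ) : ℕ∞))
    (ha : coeff (s.r + Finsupp.single f d) s.F ≠ 0)
    (hstraight : ∀ m : Fin 4 →₀ ℕ, m.degree = d → m ≠ Finsupp.single f d → coeff (s.r + m) s.F = 0)
    (htsch : coeff (s.r + (Finsupp.single f (d - 1) + Finsupp.single j 2)) s.F = 0)
    (ho' : ordZero (CentreBlowup.step p Finset.univ j 0 s).F = ((p + n : ℕ) : ℕ∞))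
    (he3' : Module.finrank K (resVertex (CentreBlowup.step p Finset.univ j 0 s)) = 3)
    {c : ℕ} (hc : c + 1 ≤ d) {a b e : ℕ}
    (h : coeff (Finsupp.single j (a + n + 1) + Finsupp.single i (b + n + 1) + Finsupp.single u (e + w) +
      Finsupp.single f (d - 1 - c)) s.F ≠ 0) :
    2 * c ≤ a + 2 * b + 2 * e := by
  by_contra hlt
  apply h
  rw [gameExp_eq_boundary_add hji hju hjf hiu hif huf a b e hr]
  set m : Fin 4 →₀ ℕ := Finsupp.single j (a + 1) + Finsupp.single i (b + 1) + Finsupp.single u e +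
    Finsupp.single f (d - 1 - c) with hm
  obtain ⟨hmj, -, -, hmf⟩ := quad_apply hji hju hjf hiu hif huf (a + 1) (b + 1) e (d - 1 - c)
  have hmdeg : m.degree = (a + 1) + (b + 1) + e + (d - 1 - c) := degree_quad j i u f _ _ _ _
  have hrdeg : s.r.degree = 2 * n + w := by
    rw [hr, map_add, map_add, Finsupp.degree_single, Finsupp.degree_single, Finsupp.degree_single]; ring
  by_cases hmd : d ≤ m.degree
  · refine (twoSlot_legal_readings_of_corner_sigma p hσ hn hd2 hji hju hjf hiu hif huf hr hdiv ho ha hstraight htsch ho'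
      he3').2.2 m hmd (by rw [hmj]; omega) fun heq => ?_
    have := DFunLike.congr_fun heq j
    rw [hmj, Finsupp.single_apply, if_neg (Ne.symm hjf)] at this
    omega
  · exact coeff_eq_zero_of_degree_lt_ordZero (by rw [ho, map_add, hrdeg]; exact_mod_cast (by omega : 2 * n + w + m.degree < p + n))

/-- **LEGAL(i) IN GAME COORDINATES, every prime, every σ** — `CInfGame.Exact.no_infinite_play`'s `hlegM` letter for letter: the same
reading for the pure corner step in the chart of the OTHER slot `i` (Tschirnhaus row now `coeff_{r + (d−1)e_f + 2e_i} F = 0`, child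
`step p univ i 0 s` of order `p + n` and `e_G = 3`): a PRESENT parent game monomial `E(c,a,b,e)`, `c + 1 ≤ d`, satisfies `2c ≤ 2a + b + 2e`.
(The `j`-theorem with the slots exchanged, read back through `gameExp_swap`.) [OURS] [cite: CossartJannsenSaito2020, Thm. 3.14] -/
theorem twoSlot_legalM_gameExp_sigma (p : ℕ) [Fact p.Prime] [CharP K p] {n w d : ℕ} (hσ : n + w + d = p) (hn : 1 ≤ n)
    (hd2 : 2 ≤ d) {s : State K} (hr : s.r = Finsupp.single j n + Finsupp.single i n + Finsupp.single u w)
    (hdiv : ∀ e ∈ s.F.support, s.r ≤ e) (ho : ordZero s.F = ((p + n : ℕ) : ℕ∞))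
    (ha : coeff (s.r + Finsupp.single f d) s.F ≠ 0)
    (hstraight : ∀ m : Fin 4 →₀ ℕ, m.degree = d → m ≠ Finsupp.single f d → coeff (s.r + m) s.F = 0)
    (htsch : coeff (s.r + (Finsupp.single f (d - 1) + Finsupp.single i 2)) s.F = 0)
    (ho' : ordZero (CentreBlowup.step p Finset.univ i 0 s).F = ((p + n : ℕ) : ℕ∞))
    (he3' : Module.finrank K (resVertex (CentreBlowup.step p Finset.univ i 0 s)) = 3)
    {c : ℕ} (hc : c + 1 ≤ d) {a b e : ℕ}
    (h : coeff (Finsupp.single j (a + n + 1) + Finsupp.single i (b + n + 1) + Finsupp.single u (e + w) +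
      Finsupp.single f (d - 1 - c)) s.F ≠ 0) :
    2 * c ≤ 2 * a + b + 2 * e := by
  have hr' : s.r = Finsupp.single i n + Finsupp.single j n + Finsupp.single u w := by rw [hr, add_comm (Finsupp.single j n)]
  rw [gameExp_swap] at h
  have := twoSlot_legal_gameExp_sigma hji.symm hiu hif hju hjf huf p hσ hn hd2 hr' hdiv ho ha hstraight htsch ho' he3' hc h
  omega

end Game

end ResCone

end Summit.ResolutionOfSingularities.ResolutionOfSingularities.Theorems.PIDim4

end
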